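/-
Copyright (c) 2026 the pub-hodgecm-mathlib formalisation cell (harness21).  Prover seat hodgecm-mathlib-F0P2-p11 (g2) (L1; LEAD F0P6-plan (g14) «(o1) KIND 1», memo
`CENSUS-K1-DealTable` brick (T4-α)), Track B «K2-LIT» ∕ hLiu418 #184♮, ROAD Φ, G5-b: SIEGEL SECTIONS PULL BACK ALONG THE DOUBLED BLOCK-DIAGONAL EMBEDDING
`blkD : H(V₁)(𝔸) × H(V₂)(𝔸) →* H(V₁ ⊕ V₂)(𝔸)` WITH THE MODULUS SHIFT `s ↦ s + n₂∕2` (resp. `s + n₁∕2`).  THEOREMS ONLY.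
-/
import Literature.NumberTheory.K2Lit.SiegelEisensteinSeriesDoubled                         -- ★ `siegelDeltaCharacter`, `IsSiegelDeltaSection`
import Literature.NumberTheory.GelbartRogawski1991.DoubledBlockDiagEmbeddingDelta           -- ★ `blkD`, `isSiegelDelta_blkD`, `chiDet_blkD`, `modDelta_blkD`
import HarnessLib

/-!
# Crux `HLiu418`, KIND 1, brick (T4-α) part 1: Siegel sections of `I_Δ^{(V)}(s, χ)` pull back along `x ↦ blkD (x, 1) · g` to Siegel sections of
# `I_Δ^{(V₁)}(s + n₂∕2, χ)` (and along `y ↦ blkD (1, y) · g` to `I_Δ^{(V₂)}(s + n₁∕2, χ)`)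

Cell `hodgecm-mathlib`, crux item hLiu418 = `stmt-HodgeConjecture-24832` (helper lane, count-neutral); squad K2 ∕ K2Liu, LEAD F0P6-plan (g14); prover F0P2-p11 (g2).
THEOREMS ONLY (no `def`, no `instance`, no notation, no named-fact hypothesis, no `sorry`).

THE SETTING (★ `DoubledBlockDiagEmbedding{,Delta}`, [Kudla1984, §1], [Kudla1994, §2], [HarrisKudlaSweet1996, §1 (1.14)–(1.15)]).  `V = V₁ ⊕ V₂` diagonal hermitian
(`dV = dA ‖ dB`, ranks `N₁, N₂`), one partner `W = diag dW` (rank `M`), enumerations `eV, eA, eB` (so `n = n₁ + n₂`, §0), the doubled groups `H(V)(𝔸)`, `H(V₁)(𝔸)`, `H(V₂)(𝔸)` and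
★ `blkD : H(V₁)(𝔸) × H(V₂)(𝔸) →* H(V)(𝔸)`.  ★ §5 of the Delta file gives `P_Δ(V₁) × P_Δ(V₂) → P_Δ(V)` and `det_Δ (blkD (h₁, h₂)) = det_Δ h₁ · det_Δ h₂`; hence the inducing
character `σ^{(V)}_{χ,s}(p) = χ(det_Δ p)·|det_Δ p|^{s + n∕2}` (★ `siegelDeltaCharacter`, written `chiDet · modDelta^{2s+n}`) restricts along `p ↦ blkD (p, 1)` to
`σ^{(V₁)}_{χ, s + n₂∕2}` — the MODULUS SHIFT `ρ_n − ρ_{n₁} = n₂∕2` — and symmetrically along `q ↦ blkD (1, q)` to `σ^{(V₂)}_{χ, s + n₁∕2}`.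
* §0 `card_eq_add` — `n = n₁ + n₂` from the three enumerations.
* §1 **`siegelDeltaCharacter_blkD_inl`** ∕ **`…_inr`** — the character identities on `P_Δ(V₁)(𝔸)` ∕ `P_Δ(V₂)(𝔸)`.
* §2 **`isSiegelDeltaSection_comp_blkD_inl`** — for `f ∈ I_Δ^{(V)}(s, χ)` and ANY `g ∈ H(V)(𝔸)`: `x ↦ f (blkD (x, 1) · g)` is a Siegel section of `I_Δ^{(V₁)}(s + n₂∕2, χ)`;
  **`isSiegelDeltaSection_comp_blkD_inr`** — `y ↦ f (blkD (1, y) · g) ∈ I_Δ^{(V₂)}(s + n₁∕2, χ)`; families versions; continuity of the pulled-back sections.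
USE (memo `F0/P2/F0P2-p11/g2/CENSUS-K1-DealTable.F0P2-p11-g2.md`, brick (T4-α)): at `N₁ = N₂ = M = 1` (`n = 2`, `n₁ = n₂ = 1`) the second summand `V₂ = L·e₂` is the CORNER LINE of a
rank-one index after ★ p861327's Levi transport, `H(V₂) = U(𝕍₂ ⊕ −𝕍₂)` is carrier «A» (the doubled LINE), and `y ↦ f_s (blkD (1, y) · Λĝ h)` is the INNER SECTION of the
K1-b♮ line term at parameter `s + ½` — a genuine Siegel section of the doubled line for EVERY translate, which is what the rank-one Whittaker theory at `n := 1` consumes.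
NOT HERE (rest of (T4-α)∕(T4-β)): `blkD (1, n⁽¹⁾ t) =` the corner line `n₂ t`, `w₀ ∈ P_Δ(𝔸)·blkD (1, w_Δ⁽¹⁾)`, and the corner-line integral as `whittakerDelta⁽¹⁾`.
HONEST LABEL.  Count-neutral helper; `HC_CM` is proved only modulo the 7 printed citations (2 remaining named inputs: hLiu418 = `stmt-HodgeConjecture-24832`,
h413 = `stmt-HodgeConjecture-24833`) until rung 0 closes.

## References
* [Kudla1994] S. Kudla, *Splitting metaplectic covers of dual reductive pairs*, Israel J. Math. 87 (1994), §2, Thm. 3.1.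
* [HarrisKudlaSweet1996] M. Harris, S. Kudla, W. Sweet, *Theta dichotomy for unitary groups*, J. AMS 9 (1996), §1 (1.14)–(1.15).
* [KudlaRallis1994] S. Kudla, S. Rallis, Ann. of Math. 140 (1994), §2 (singular coefficients through lower-rank doubled groups).
* [Tan1999] V. Tan, Canad. J. Math. 51 (1999), §1.
-/

set_option autoImplicit false
set_option linter.dupNamespace false -- the mandated namespace repeats `HodgeConjecture.HodgeConjecture`

noncomputable section

open scoped Matrix
open NumberField IsDedekindDomain
open Literature.NumberTheory.Automorphic Literature.NumberTheory.GaloisRepresentations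
open Literature.NumberTheory.GelbartRogawski1991 Literature.NumberTheory.GelbartRogawski1991.GRConstruction
open Literature.NumberTheory.K2Lit.SiegelDoubled

namespace Summit.HodgeConjecture.HodgeConjecture.Cruxes.HLiu418.K2LiuBlockDiagSectionPullback

variable (L : Type) [Field L] [NumberField L] [IsCMField L]
variable {N₁ N₂ M n n₁ n₂ : ℕ} (eV : Fin (N₁ + N₂) × Fin M ≃ Fin n) (eA : Fin N₁ × Fin M ≃ Fin n₁) (eB : Fin N₂ × Fin M ≃ Fin n₂)
  (dA : Fin N₁ → L) (hdA : ∀ i, IsCMField.complexConj L (dA i) = dA i)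
  (dB : Fin N₂ → L) (hdB : ∀ i, IsCMField.complexConj L (dB i) = dB i)
  (dV : Fin (N₁ + N₂) → L) (hdV : ∀ i, IsCMField.complexConj L (dV i) = dV i)
  (hVA : ∀ i, dV (Fin.castAdd N₂ i) = dA i) (hVB : ∀ j, dV (Fin.natAdd N₁ j) = dB j)
  (dW : Fin M → L) (hdW : ∀ i, IsCMField.complexConj L (dW i) = dW i)

/-! ## §0 `n = n₁ + n₂` -/

include eV eA eB in
omit L in
/-- the three enumerations force `n = n₁ + n₂` (`(N₁ + N₂)·M = N₁·M + N₂·M`). [cite: Kudla1994, §2] -/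
theorem card_eq_add : n = n₁ + n₂ := by
  have hV := Fintype.card_congr eV
  have hA := Fintype.card_congr eA
  have hB := Fintype.card_congr eB
  simp only [Fintype.card_prod, Fintype.card_fin] at hV hA hB
  rw [← hV, ← hA, ← hB, add_mul]

include eV eA eB in
omit L in
/-- the exponent bookkeeping of the modulus shift along the FIRST summand: `2s + n = 2(s + n₂∕2) + n₁`. [cite: Kudla1994, §2] -/
theorem exponent_inl (s : ℂ) : 2 * s + (n : ℂ) = 2 * (s + (n₂ : ℂ) / 2) + (n₁ : ℂ) := by
  rw [card_eq_add eV eA eB]; push_cast; ring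

include eV eA eB in
omit L in
/-- the exponent bookkeeping of the modulus shift along the SECOND summand: `2s + n = 2(s + n₁∕2) + n₂`. [cite: Kudla1994, §2] -/
theorem exponent_inr (s : ℂ) : 2 * s + (n : ℂ) = 2 * (s + (n₁ : ℂ) / 2) + (n₂ : ℂ) := by
  rw [card_eq_add eV eA eB]; push_cast; ring

/-! ## §1 The inducing character along `blkD (p, 1)` and `blkD (1, q)` -/

/-- **`σ^{(V)}_{χ,s}(blkD (p, 1)) = σ^{(V₁)}_{χ, s + n₂∕2}(p)`** for `p ∈ P_Δ(V₁)(𝔸)` (★ `chiDet_blkD`, ★ `modDelta_blkD`, `det_Δ 1 = 1`, and `det_Δ p` is a unit on the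
Siegel parabolic ★ `isUnit_detDelta_of_isSiegelDelta`). [cite: Kudla1994, §2, Thm. 3.1] [cite: HarrisKudlaSweet1996, §1 (1.14)–(1.15)] -/
theorem siegelDeltaCharacter_blkD_inl (χ : HeckeCharacter L) (s : ℂ) {p : HA L eA dA hdA dW hdW} (hp : IsSiegelDelta L eA dA hdA dW hdW p) :
    siegelDeltaCharacter L eV dV hdV dW hdW χ s (blkD L eV eA eB dA hdA dB hdB dV hdV hVA hVB dW hdW (p, 1)) =
      siegelDeltaCharacter L eA dA hdA dW hdW χ (s + (n₂ : ℂ) / 2) p := by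
  have hpU : IsUnit (detDelta L eA dA hdA dW hdW p) := isUnit_detDelta_of_isSiegelDelta L eA dA hdA dW hdW p hp
  have h1U : IsUnit (detDelta L eB dB hdB dW hdW (1 : HA L eB dB hdB dW hdW)) := by
    rw [detDelta_one']; exact isUnit_one
  unfold siegelDeltaCharacter
  rw [chiDet_blkD L eV eA eB dA hdA dB hdB dV hdV hVA hVB dW hdW χ (h := (p, 1)) hpU h1U,
    modDelta_blkD L eV eA eB dA hdA dB hdB dV hdV hVA hVB dW hdW (h := (p, 1)) hpU h1U, chiDet_one', modDelta_one', mul_one, mul_one,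
    exponent_inl eV eA eB s]

/-- **`σ^{(V)}_{χ,s}(blkD (1, q)) = σ^{(V₂)}_{χ, s + n₁∕2}(q)`** for `q ∈ P_Δ(V₂)(𝔸)`. [cite: Kudla1994, §2, Thm. 3.1] [cite: HarrisKudlaSweet1996, §1 (1.14)–(1.15)] -/
theorem siegelDeltaCharacter_blkD_inr (χ : HeckeCharacter L) (s : ℂ) {q : HA L eB dB hdB dW hdW} (hq : IsSiegelDelta L eB dB hdB dW hdW q) :
    siegelDeltaCharacter L eV dV hdV dW hdW χ s (blkD L eV eA eB dA hdA dB hdB dV hdV hVA hVB dW hdW (1, q)) =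
      siegelDeltaCharacter L eB dB hdB dW hdW χ (s + (n₁ : ℂ) / 2) q := by
  have hqU : IsUnit (detDelta L eB dB hdB dW hdW q) := isUnit_detDelta_of_isSiegelDelta L eB dB hdB dW hdW q hq
  have h1U : IsUnit (detDelta L eA dA hdA dW hdW (1 : HA L eA dA hdA dW hdW)) := by
    rw [detDelta_one']; exact isUnit_one
  unfold siegelDeltaCharacter
  rw [chiDet_blkD L eV eA eB dA hdA dB hdB dV hdV hVA hVB dW hdW χ (h := (1, q)) h1U hqU,
    modDelta_blkD L eV eA eB dA hdA dB hdB dV hdV hVA hVB dW hdW (h := (1, q)) h1U hqU, chiDet_one', modDelta_one', one_mul, one_mul,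
    exponent_inr eV eA eB s]

/-! ## §2 Siegel sections pull back, with the modulus shift, for EVERY translate -/

/-- **SIEGEL SECTIONS PULL BACK ALONG THE FIRST SUMMAND**: `f ∈ I_Δ^{(V)}(s, χ)`, `g ∈ H(V)(𝔸)` arbitrary ⟹ `x ↦ f (blkD (x, 1) · g) ∈ I_Δ^{(V₁)}(s + n₂∕2, χ)`
(`blkD` is a homomorphism, ★ `isSiegelDelta_blkD`, §1). [cite: KudlaRallis1994, §2] [cite: Kudla1994, §2, Thm. 3.1] [cite: Tan1999, §1] -/
theorem isSiegelDeltaSection_comp_blkD_inl {χ : HeckeCharacter L} {s : ℂ} {f : HA L eV dV hdV dW hdW → ℂ}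
    (hf : IsSiegelDeltaSection L eV dV hdV dW hdW χ s f) (g : HA L eV dV hdV dW hdW) :
    IsSiegelDeltaSection L eA dA hdA dW hdW χ (s + (n₂ : ℂ) / 2)
      (fun x => f (blkD L eV eA eB dA hdA dB hdB dV hdV hVA hVB dW hdW (x, 1) * g)) := by
  intro p hp x
  have hmul : blkD L eV eA eB dA hdA dB hdB dV hdV hVA hVB dW hdW (p * x, 1) =
      blkD L eV eA eB dA hdA dB hdB dV hdV hVA hVB dW hdW (p, 1) * blkD L eV eA eB dA hdA dB hdB dV hdV hVA hVB dW hdW (x, 1) := by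
    rw [← map_mul, Prod.mk_mul_mk, mul_one]
  show f (blkD L eV eA eB dA hdA dB hdB dV hdV hVA hVB dW hdW (p * x, 1) * g) = _
  rw [hmul, mul_assoc, hf _ (isSiegelDelta_blkD L eV eA eB dA hdA dB hdB dV hdV hVA hVB dW hdW hp (isSiegelDelta_one' L eB dB hdB dW hdW)),
    siegelDeltaCharacter_blkD_inl L eV eA eB dA hdA dB hdB dV hdV hVA hVB dW hdW χ s hp]

/-- **SIEGEL SECTIONS PULL BACK ALONG THE SECOND SUMMAND**: `f ∈ I_Δ^{(V)}(s, χ)`, `g ∈ H(V)(𝔸)` ⟹ `y ↦ f (blkD (1, y) · g) ∈ I_Δ^{(V₂)}(s + n₁∕2, χ)` — at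
`N₁ = N₂ = M = 1` the INNER SECTION of the rank-one line term on carrier «A» at parameter `s + ½`. [cite: KudlaRallis1994, §2] [cite: Kudla1994, §2, Thm. 3.1] [cite: Tan1999, §1] -/
theorem isSiegelDeltaSection_comp_blkD_inr {χ : HeckeCharacter L} {s : ℂ} {f : HA L eV dV hdV dW hdW → ℂ}
    (hf : IsSiegelDeltaSection L eV dV hdV dW hdW χ s f) (g : HA L eV dV hdV dW hdW) :
    IsSiegelDeltaSection L eB dB hdB dW hdW χ (s + (n₁ : ℂ) / 2)
      (fun y => f (blkD L eV eA eB dA hdA dB hdB dV hdV hVA hVB dW hdW (1, y) * g)) := by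
  intro q hq y
  have hmul : blkD L eV eA eB dA hdA dB hdB dV hdV hVA hVB dW hdW (1, q * y) =
      blkD L eV eA eB dA hdA dB hdB dV hdV hVA hVB dW hdW (1, q) * blkD L eV eA eB dA hdA dB hdB dV hdV hVA hVB dW hdW (1, y) := by
    rw [← map_mul, Prod.mk_mul_mk, mul_one]
  show f (blkD L eV eA eB dA hdA dB hdB dV hdV hVA hVB dW hdW (1, q * y) * g) = _
  rw [hmul, mul_assoc, hf _ (isSiegelDelta_blkD L eV eA eB dA hdA dB hdB dV hdV hVA hVB dW hdW (isSiegelDelta_one' L eA dA hdA dW hdW) hq),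
    siegelDeltaCharacter_blkD_inr L eV eA eB dA hdA dB hdB dV hdV hVA hVB dW hdW χ s hq]

/-- families version (first summand): a family of Siegel sections `f_s ∈ I_Δ^{(V)}(s, χ)` pulls back to the family `s ↦ (x ↦ f_s (blkD (x, 1) · g))` of Siegel sections of
`I_Δ^{(V₁)}(s + n₂∕2, χ)`. [cite: KudlaRallis1994, §2] [cite: Tan1999, §1] -/
theorem isSiegelDeltaSection_family_comp_blkD_inl {χ : HeckeCharacter L} {f : ℂ → HA L eV dV hdV dW hdW → ℂ}
    (hf : ∀ s, IsSiegelDeltaSection L eV dV hdV dW hdW χ s (f s)) (g : HA L eV dV hdV dW hdW) (s : ℂ) :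
    IsSiegelDeltaSection L eA dA hdA dW hdW χ (s + (n₂ : ℂ) / 2)
      (fun x => f s (blkD L eV eA eB dA hdA dB hdB dV hdV hVA hVB dW hdW (x, 1) * g)) :=
  isSiegelDeltaSection_comp_blkD_inl L eV eA eB dA hdA dB hdB dV hdV hVA hVB dW hdW (hf s) g

/-- families version (second summand). [cite: KudlaRallis1994, §2] [cite: Tan1999, §1] -/
theorem isSiegelDeltaSection_family_comp_blkD_inr {χ : HeckeCharacter L} {f : ℂ → HA L eV dV hdV dW hdW → ℂ}
    (hf : ∀ s, IsSiegelDeltaSection L eV dV hdV dW hdW χ s (f s)) (g : HA L eV dV hdV dW hdW) (s : ℂ) :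
    IsSiegelDeltaSection L eB dB hdB dW hdW χ (s + (n₁ : ℂ) / 2)
      (fun y => f s (blkD L eV eA eB dA hdA dB hdB dV hdV hVA hVB dW hdW (1, y) * g)) :=
  isSiegelDeltaSection_comp_blkD_inr L eV eA eB dA hdA dB hdB dV hdV hVA hVB dW hdW (hf s) g

/-- the pulled-back section along the first summand is continuous when `f` is (★ `continuous_blkD`). [cite: Kudla1994, §2] -/
theorem continuous_comp_blkD_inl {f : HA L eV dV hdV dW hdW → ℂ} (hfc : Continuous f) (g : HA L eV dV hdV dW hdW) :
    Continuous fun x : HA L eA dA hdA dW hdW => f (blkD L eV eA eB dA hdA dB hdB dV hdV hVA hVB dW hdW (x, 1) * g) :=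
  hfc.comp (((continuous_blkD L eV eA eB dA hdA dB hdB dV hdV hVA hVB dW hdW).comp (continuous_id.prodMk continuous_const)).mul
    continuous_const)

/-- the pulled-back section along the second summand is continuous when `f` is (★ `continuous_blkD`). [cite: Kudla1994, §2] -/
theorem continuous_comp_blkD_inr {f : HA L eV dV hdV dW hdW → ℂ} (hfc : Continuous f) (g : HA L eV dV hdV dW hdW) :
    Continuous fun y : HA L eB dB hdB dW hdW => f (blkD L eV eA eB dA hdA dB hdB dV hdV hVA hVB dW hdW (1, y) * g) :=
  hfc.comp (((continuous_blkD L eV eA eB dA hdA dB hdB dV hdV hVA hVB dW hdW).comp (continuous_const.prodMk continuous_id)).mul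
    continuous_const)

end Summit.HodgeConjecture.HodgeConjecture.Cruxes.HLiu418.K2LiuBlockDiagSectionPullback

end
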